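import Summits.ValiantsHypothesis.ValiantsHypothesis.Theorems.AnyonJetsJetConstantElimScalarRestriction
import Summits.ValiantsHypothesis.ValiantsHypothesis.Theorems.AnyonJetsJetConstantElimPaddingHomogenisation
import Summits.ValiantsHypothesis.ValiantsHypothesis.Theorems.AnyonJetsConstantFreeJetGrowthDefs
import Mathlib.LinearAlgebra.LinearIndependent.Lemmas
import HarnessLib

/-!
# AnyonJets — crux `JetConstantElim` (stmt-ValiantsHypothesis-16737), stub `stub_integralMultiple`:
# the bounded-degree bounded-height slice (restriction of scalars + denominators + height)

Line `Cruxes/JetConstantElim/Lines/birth.lean`, OPEN stub `stub_integralMultiple` (`IM`). Its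
content splits as (i) irrationality — the DEGREE of the field of definition of a near-optimal
`ℚ̄`-circuit, (ii) denominators, (iii) HEIGHT of the constants. This file proves, for EVERY
integer polynomial `f`, that (ii) is free and that (i), (iii) cost only polynomially in the degree
and the height — so what the stub asks beyond this file is exactly the height normal form
"near-optimal circuits of the jets are definable over a number field of polynomial degree with
constants of polynomial height" (`Cruxes/JetConstantElim/INTEGRAL-MULTIPLE-CENSUS.md`):

* `aeval_padded_skeleton` — the padded integer skeleton of a `K`-circuit `Q` for `f`
  (`…PaddingHomogenisation.exists_padded_circuit` on Bürgisser's `skeleton Q`) evaluates, under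
  `z ↦ N`, `Y_v ↦ N · slotConst Q v`, to `N^(2^(3 size Q)) · f` — over ANY commutative ring `K`.
* `eq_of_sum_C_mul_map_eq` — reading off the unit coordinate along a `ℚ`-independent `β ∋ 1`.
* `exists_integralMultiple_of_numberField_circuit` — **the slice**: `K` a field of
  characteristic `0`, `β : Fin (d+1) → K` `ℚ`-independent with `β 0 = 1` and an integer
  multiplication table `γ` (e.g. the power basis of an algebraic integer generating a number
  field of degree `d+1`), `Q` a fan-in-two `K`-circuit for `f` whose skeleton constants satisfy
  `N · slotConst Q v = Σ_l P_{vl} β_l` with `N, P, γ` of height `≤ 2^h`: then a SIGN-CONSTANT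
  integer circuit of size `≤ 128 (d+1)³ (size Q + h + 2)² − 2` computes `N^(2^(3 size Q)) · f`
  (restriction of scalars `…ScalarRestriction.exists_coordinate_circuit` on the padded skeleton,
  then substitution of the integers, `τ(c) ≤ 3 log₂|c| + 4`).
* `integralMultiple_numberFieldSlice` — the same in the shape of the stub for the jets `J_(n,k)`.

Honest framing: a free slice of an open, conjecture-grade stub; the crux `JetConstantElim` stays
open; VP ≠ VNP is NOT proved here.

References: P. Bürgisser, M. Clausen, M. A. Shokrollahi, *Algebraic Complexity Theory* (1997),
§4.1; P. Bürgisser, *Completeness and Reduction in Algebraic Complexity Theory* (2000), §4.1;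
P. Bürgisser, *Cook's versus Valiant's hypothesis*, TCS 235 (2000), §5; V. Strassen,
*Vermeidung von Divisionen*, Crelle 264 (1973).
-/

noncomputable section

-- single-conjunct layout: Sub = Summit, duplicated namespace component intended
set_option linter.dupNamespace false

namespace Summit.ValiantsHypothesis.ValiantsHypothesis.Theorems.AnyonJets.JetConstantElim

open MvPolynomial Literature.Computability.AlgebraicComplexity
open Literature.Computability.AlgebraicComplexity.ArithCircuit
open Summit.ValiantsHypothesis.ValiantsHypothesis.Theorems.AnyonJets.ConstantFreeJetGrowth (jet)
open scoped BigOperators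

/-! ### Three tools -/

/-- Partial substitution bound for `τ` with an arbitrary FINITE block of substituted variables
(the tree's `constantFreeComplexity_aeval_sumElim_le` is the `Fin m` case). [cite: Burgisser2000, Rem. 2.7] -/
theorem constantFreeComplexity_aeval_sumElim_le_fintype {σ ρ : Type*} [Fintype ρ]
    (F : MvPolynomial (σ ⊕ ρ) ℤ) (g : ρ → MvPolynomial σ ℤ) :
    constantFreeComplexity (aeval (Sum.elim X g) F) ≤
      constantFreeComplexity F + ∑ j, constantFreeComplexity (g j) := by
  classical
  set e := Fintype.equivFin ρ with he
  have hfun : (Sum.elim X g : σ ⊕ ρ → MvPolynomial σ ℤ) = Sum.elim X (g ∘ e.symm) ∘ Sum.map id e := by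
    funext x
    rcases x with x | r <;> simp
  have hre : aeval (Sum.elim X g) F =
      aeval (Sum.elim X (g ∘ e.symm)) (rename (Sum.map id e) F) := by
    rw [aeval_rename, ← hfun]
  rw [hre]
  calc constantFreeComplexity (aeval (Sum.elim X (g ∘ ⇑e.symm)) (rename (Sum.map id ⇑e) F))
      ≤ constantFreeComplexity (rename (Sum.map id ⇑e) F) +
          ∑ j, constantFreeComplexity ((g ∘ ⇑e.symm) j) :=
        constantFreeComplexity_aeval_sumElim_le _ _
    _ ≤ constantFreeComplexity F + ∑ j, constantFreeComplexity (g j) := by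
        apply add_le_add (constantFreeComplexity_rename_le _ _)
        rw [← e.symm.sum_comp]
        rfl

/-- **Evaluation of the padded skeleton over any commutative ring `K`**: if `H` satisfies the
padding identity `κ(H) = z^E · F` for Bürgisser's integer skeleton `F` of a fan-in-two
`K`-circuit `Q` computing `f ∈ ℤ[x]` (weights `0` on the variables of `f`, `1` on the slots),
then substituting `z ↦ N` and `Y_v ↦ N · slotConst Q v` in `H` gives `N^E · f`.
[folklore; Bürgisser 2000 TCS §5 (skeleton), Strassen 1973 (padding)] -/
theorem aeval_padded_skeleton {σ K : Type*} [CommRing K] (f : MvPolynomial σ ℤ)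
    (Q : ArithCircuit K σ) (h2 : Q.IsFanInTwo)
    (hc : Q.Computes (MvPolynomial.map (Int.castRingHom K) f)) (N : ℕ) {E : ℕ}
    (c' : Fin (4 * Q.size + 1) → K) (hc' : ∀ v : Fin (4 * Q.size + 1), (N : K) * slotConst Q v = c' v)
    {H : MvPolynomial (Option (σ ⊕ Fin (4 * Q.size + 1))) ℤ}
    (hκ : aeval (fun o : Option (σ ⊕ Fin (4 * Q.size + 1)) => Option.elim o (X none)
        (fun i => X (some i) * X none ^ (Sum.elim (fun _ => 0) (fun _ => 1) i : ℕ))) H =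
      X none ^ E * rename some (skeleton Q).eval) :
    aeval (fun o : Option (σ ⊕ Fin (4 * Q.size + 1)) =>
        Option.elim o (C (N : K)) (Sum.elim X (fun v => C (c' v)))) H =
      C ((N : K) ^ E) * MvPolynomial.map (Int.castRingHom K) f := by
  classical
  have hΓeval : aeval (slotSubst Q) (skeleton Q).eval = MvPolynomial.map (Int.castRingHom K) f :=
    (aeval_slotSubst_skeleton Q h2).trans hc
  set evK : Option (σ ⊕ Fin (4 * Q.size + 1)) → MvPolynomial σ K :=
    fun o => Option.elim o (C (N : K)) (Sum.elim X (fun v => C (slotConst Q v))) with hevK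
  -- the two substitutions agree after `κ`
  have hF : ∀ o : Option (σ ⊕ Fin (4 * Q.size + 1)),
      (Option.elim o (C (N : K)) (Sum.elim X (fun v => C (c' v))) : MvPolynomial σ K) =
        bind₁ evK (MvPolynomial.map (Int.castRingHom K)
          (Option.elim o (X none) (fun i => X (some i) *
            X none ^ (Sum.elim (fun _ => 0) (fun _ => 1) i : ℕ)) :
            MvPolynomial (Option (σ ⊕ Fin (4 * Q.size + 1))) ℤ)) := by
    intro o
    rcases o with _ | (x | v)
    · simp [hevK]
    · simp [hevK]
    · have hC : (C (c' v) : MvPolynomial σ K) = C (slotConst Q v) * C (N : K) := by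
        rw [← map_mul, mul_comm, hc' v]
      simpa [hevK] using hC
  have hL : aeval (fun o : Option (σ ⊕ Fin (4 * Q.size + 1)) =>
        Option.elim o (C (N : K)) (Sum.elim X (fun v => C (c' v)))) H =
      bind₁ evK (MvPolynomial.map (Int.castRingHom K)
        (aeval (fun o : Option (σ ⊕ Fin (4 * Q.size + 1)) => Option.elim o (X none)
          (fun i => X (some i) * X none ^ (Sum.elim (fun _ => 0) (fun _ => 1) i : ℕ))) H)) := by
    rw [← MvPolynomial.aeval_map_algebraMap (A := K), aeval_eq_bind₁]
    conv_rhs => rw [aeval_eq_bind₁, map_bind₁, bind₁_bind₁]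
    exact congrArg (fun F => bind₁ F (MvPolynomial.map (algebraMap ℤ K) H)) (funext hF)
  have hslot : (evK ∘ some) = slotSubst Q := by
    funext i; rcases i with x | v <;> simp [hevK, slotSubst]
  have hmapalg : MvPolynomial.map (Int.castRingHom K) (skeleton Q).eval =
      MvPolynomial.map (algebraMap ℤ K) (skeleton Q).eval := rfl
  rw [hL, hκ, map_mul, map_pow, map_X, map_rename, map_mul, map_pow, bind₁_X_right, bind₁_rename,
    hslot, ← aeval_eq_bind₁, hmapalg, aeval_map_algebraMap, hΓeval]
  simp [hevK]

/-- **Reading off the unit coordinate**: if `Σ_l C(β l) · A_l^K = g^K` for integer polynomials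
`A_l`, `g` and a `ℚ`-linearly independent `β` with `β 0 = 1`, then `A_0 = g`. [folklore] -/
theorem eq_of_sum_C_mul_map_eq {σ K : Type*} [Field K] [CharZero K] {d : ℕ}
    (β : Fin (d + 1) → K) (hβ0 : β 0 = 1) (hind : LinearIndependent ℚ β)
    (A : Fin (d + 1) → MvPolynomial σ ℤ) (g : MvPolynomial σ ℤ)
    (h : ∑ l, C (β l) * MvPolynomial.map (Int.castRingHom K) (A l) =
      MvPolynomial.map (Int.castRingHom K) g) :
    A 0 = g := by
  classical
  ext m
  have hm := congrArg (coeff m) h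
  simp only [coeff_sum, coeff_C_mul, coeff_map, eq_intCast] at hm
  -- the rational relation `Σ_l c_l • β_l = 0`
  set c : Fin (d + 1) → ℚ := fun l =>
    ((coeff m (A l) : ℤ) : ℚ) - if l = 0 then ((coeff m g : ℤ) : ℚ) else 0 with hc
  have hrel : ∑ l, c l • β l = 0 := by
    have hsplit : ∑ l, c l • β l =
        ∑ l, (((coeff m (A l) : ℤ) : ℚ) • β l) - ((coeff m g : ℤ) : ℚ) • β 0 := by
      simp only [hc, sub_smul, Finset.sum_sub_distrib, ite_smul, zero_smul, Finset.sum_ite_eq',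
        Finset.mem_univ, if_true]
    rw [hsplit, hβ0]
    have hcast : ∀ (z : ℤ) (x : K), ((z : ℚ) • x) = (z : K) * x := fun z x => by
      rw [Rat.smul_def, Rat.cast_intCast]
    simp only [hcast, mul_one]
    rw [← hm]
    simp [mul_comm]
  have h0 := (Fintype.linearIndependent_iff.mp hind) c hrel 0
  simp only [hc, if_true, sub_eq_zero] at h0
  exact_mod_cast h0

/-- Envelope arithmetic for the bounded-degree slice. [folklore] -/
theorem numberField_envelope_le (s h d : ℕ) :
    (3 * (d + 1) ^ 3 + (d + 1)) * (2 * (3 * s + 2) ^ 2) +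
        ((3 * (h + 1) + 1) + (4 * s + 1) * (d + 1) * (3 * (h + 1) + 1) +
          (d + 1) ^ 3 * (3 * (h + 1) + 1)) + 2 ≤
      128 * (d + 1) ^ 3 * (s + h + 2) ^ 2 := by
  set D := d + 1 with hD
  set X := s + h + 2 with hX
  have hD1 : 1 ≤ D := by omega
  have hX2 : 2 ≤ X := by omega
  have hD3 : D ≤ D ^ 3 := Nat.le_self_pow (by norm_num) D
  have hD31 : 1 ≤ D ^ 3 := Nat.one_le_pow _ _ hD1
  set T := D ^ 3 * X ^ 2 with hT
  have hT1 : 1 ≤ T := Nat.one_le_iff_ne_zero.mpr (by positivity)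
  have h1 : (3 * D ^ 3 + D) * (2 * (3 * s + 2) ^ 2) ≤ 72 * T := by
    have ha : 3 * D ^ 3 + D ≤ 4 * D ^ 3 := by omega
    have hb : 2 * (3 * s + 2) ^ 2 ≤ 18 * X ^ 2 := by nlinarith
    calc (3 * D ^ 3 + D) * (2 * (3 * s + 2) ^ 2) ≤ (4 * D ^ 3) * (18 * X ^ 2) :=
          Nat.mul_le_mul ha hb
      _ = 72 * T := by rw [hT]; ring
  have hhx : 3 * (h + 1) + 1 ≤ 2 * X ^ 2 := by nlinarith
  have h2 : 3 * (h + 1) + 1 ≤ 2 * T := by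
    calc 3 * (h + 1) + 1 ≤ 2 * X ^ 2 := hhx
      _ = 1 * (2 * X ^ 2) := (one_mul _).symm
      _ ≤ D ^ 3 * (2 * X ^ 2) := Nat.mul_le_mul_right _ hD31
      _ = 2 * T := by rw [hT]; ring
  have h3 : (4 * s + 1) * D * (3 * (h + 1) + 1) ≤ 16 * T := by
    have ha : 4 * s + 1 ≤ 4 * X := by omega
    have hb : 3 * (h + 1) + 1 ≤ 4 * X := by omega
    calc (4 * s + 1) * D * (3 * (h + 1) + 1) ≤ (4 * X) * D ^ 3 * (4 * X) :=
          Nat.mul_le_mul (Nat.mul_le_mul ha hD3) hb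
      _ = 16 * T := by rw [hT]; ring
  have h4 : D ^ 3 * (3 * (h + 1) + 1) ≤ 2 * T := by
    calc D ^ 3 * (3 * (h + 1) + 1) ≤ D ^ 3 * (2 * X ^ 2) := Nat.mul_le_mul_left _ hhx
      _ = 2 * T := by rw [hT]; ring
  have h5 : 128 * (d + 1) ^ 3 * (s + h + 2) ^ 2 = 128 * T := by rw [hT, hD, hX]; ring
  rw [h5]
  omega

/-- **The bounded-degree bounded-height slice of `stub_integralMultiple`** (any `f ∈ ℤ[x]`): let
`K` be a field of characteristic `0`, `β : Fin (d+1) → K` a `ℚ`-linearly independent family with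
`β 0 = 1` and an INTEGER multiplication table `β a β b = Σ_l γ_{abl} β l` (e.g. the power basis of
an algebraic integer generating a number field of degree `d + 1`). If a fan-in-two `K`-circuit `Q`
computes `f` and its skeleton constants satisfy `N · slotConst Q v = Σ_l P_{vl} β l` with integers
`N, P_{vl}, γ_{abl}` of height `≤ 2^h` (`N ≥ 1`), then some SIGN-CONSTANT integer fan-in-two
circuit of size `≤ 128 (d+1)³ (size Q + h + 2)² - 2` computes `N^(2^(3 size Q)) · f`: padding
homogenisation of Bürgisser's skeleton (denominators), restriction of scalars on the coordinates
of `β` (irrationality of bounded degree), substitution of the bounded-height integers (height).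
[folklore; Bürgisser–Clausen–Shokrollahi 1997 §4.1, Bürgisser 2000 §4.1, Strassen 1973] -/
theorem exists_integralMultiple_of_numberField_circuit {σ K : Type*} [Field K] [CharZero K]
    (f : MvPolynomial σ ℤ) {d : ℕ} (β : Fin (d + 1) → K) (hβ0 : β 0 = 1)
    (hind : LinearIndependent ℚ β) (γ : Fin (d + 1) → Fin (d + 1) → Fin (d + 1) → ℤ)
    (hβ : ∀ a b, β a * β b = ∑ l, (γ a b l : K) * β l)
    (Q : ArithCircuit K σ) (h2 : Q.IsFanInTwo)
    (hc : Q.Computes (MvPolynomial.map (Int.castRingHom K) f)) (N h : ℕ) (hN1 : 1 ≤ N)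
    (hNh : N ≤ 2 ^ h) (P : Fin (4 * Q.size + 1) → Fin (d + 1) → ℤ)
    (hP : ∀ v : Fin (4 * Q.size + 1), (N : K) * slotConst Q v = ∑ l, (P v l : K) * β l)
    (hPh : ∀ v l, (P v l).natAbs ≤ 2 ^ h) (hγh : ∀ a b l, (γ a b l).natAbs ≤ 2 ^ h) :
    ∃ (Pc : ArithCircuit ℤ σ) (t M : ℕ),
      1 ≤ M ∧ Pc.IsFanInTwo ∧ Pc.Computes ((M : ℤ) • f) ∧
      ((∀ g ∈ Pc.gates, ∀ u ∈ g.args, ∀ c : ℤ, u = .const c → c.natAbs ≤ 2 ^ t) ∧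
        (∀ args : List (ℤ × Operand ℤ σ), Gate.sum args ∈ Pc.gates →
          ∀ a ∈ args, a.1.natAbs ≤ 2 ^ t) ∧
        (∀ c : ℤ, Pc.output = .const c → c.natAbs ≤ 2 ^ t)) ∧
      Pc.size + t + 2 ≤ 128 * (d + 1) ^ 3 * (Q.size + h + 2) ^ 2 := by
  classical
  -- (1) skeleton and padding
  obtain ⟨Γ', hΓ'2, hΓ's, hΓ'size, hκ⟩ := exists_padded_circuit
    (Sum.elim (fun _ => 0) (fun _ => 1) : σ ⊕ Fin (4 * Q.size + 1) → ℕ)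
    (by rintro (i | i) <;> simp) (skeleton Q) (isFanInTwo_skeleton Q) (hasSignConstants_skeleton Q)
  rw [size_skeleton] at hΓ'size hκ
  have hev := aeval_padded_skeleton f Q h2 hc N (fun v => ∑ l, (P v l : K) * β l) hP hκ
  -- (2) reshape the variables: scalar `Option σ` (`none` = z), K-valued `Fin (4s+1)`
  set e : Option (σ ⊕ Fin (4 * Q.size + 1)) → Option σ ⊕ Fin (4 * Q.size + 1) :=
    fun o => Option.elim o (Sum.inl none) (Sum.elim (fun x => Sum.inl (some x)) Sum.inr) with he
  have hΓ''2 : (Γ'.rename e).IsFanInTwo := hΓ'2.rename e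
  have hΓ''s : (Γ'.rename e).HasSignConstants := hΓ's.rename e
  have hΓ''size : (Γ'.rename e).size = Γ'.size := size_rename e Γ'
  have hΓ''eval : (Γ'.rename e).eval = rename e Γ'.eval := eval_rename_apply e Γ'
  -- (3) the coordinate data
  set ρK : Option σ ⊕ Fin (4 * Q.size + 1) → MvPolynomial σ K :=
    Sum.elim (fun a => Option.elim a (C (N : K)) X) (fun v => C (∑ l, (P v l : K) * β l)) with hρK
  set ρZ : Option σ ⊕ ((Fin (4 * Q.size + 1) × Fin (d + 1)) ⊕ (Fin (d + 1) × Fin (d + 1) × Fin (d + 1))) →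
      MvPolynomial σ ℤ :=
    Sum.elim (fun a => Option.elim a (C (N : ℤ)) X)
      (Sum.elim (fun vl => C (P vl.1 vl.2)) (fun abl => C (γ abl.1 abl.2.1 abl.2.2))) with hρZ
  have hsc : ∀ a, ρK (Sum.inl a) = MvPolynomial.map (Int.castRingHom K) (ρZ (Sum.inl a)) := by
    rintro (_ | x) <;> simp [hρK, hρZ]
  have hK : ∀ v, ρK (Sum.inr v) = ∑ l : Fin (d + 1), C (β l) *
      MvPolynomial.map (Int.castRingHom K) (ρZ (Sum.inr (Sum.inl (v, l)))) := by
    intro v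
    simp only [hρK, hρZ, Sum.elim_inr, Sum.elim_inl, map_sum, map_mul, map_intCast, eq_intCast]
    exact Finset.sum_congr rfl fun l _ => mul_comm _ _
  have hβ' : ∀ a b : Fin (d + 1), C (β a) * C (β b) = ∑ l : Fin (d + 1),
      MvPolynomial.map (Int.castRingHom K) (ρZ (Sum.inr (Sum.inr (a, b, l)))) * C (β l) := by
    intro a b
    rw [← map_mul, hβ, map_sum]
    exact Finset.sum_congr rfl fun l _ => by simp [hρZ]
  obtain ⟨Γc, q, hΓc2, hΓcs, hΓcsize, hΓceval, hI⟩ :=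
    exists_coordinate_circuit hβ0 hsc hK hβ' (Γ'.rename e) hΓ''2 hΓ''s
  -- (4) the unit coordinate is `N^E • f`
  have hρe : (ρK ∘ e) = fun o : Option (σ ⊕ Fin (4 * Q.size + 1)) =>
      Option.elim o (C (N : K)) (Sum.elim X (fun v => C (∑ l, (P v l : K) * β l))) := by
    funext o
    rcases o with _ | (x | v) <;> simp [hρK, he]
  have hstar : ∑ l : Fin (d + 1), C (β l) * MvPolynomial.map (Int.castRingHom K) (aeval ρZ (q l)) =
      MvPolynomial.map (Int.castRingHom K) (((N : ℤ) ^ 2 ^ (3 * Q.size)) • f) := by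
    rw [← hI, hΓ''eval, aeval_rename, hρe, hev, smul_eq_C_mul, map_mul, map_C]
    simp
  have hA0 : aeval ρZ (q 0) = ((N : ℤ) ^ 2 ^ (3 * Q.size)) • f :=
    eq_of_sum_C_mul_map_eq β hβ0 hind (fun l => aeval ρZ (q l)) _ hstar
  -- (5) substituting the integers: cost
  set g' : Unit ⊕ ((Fin (4 * Q.size + 1) × Fin (d + 1)) ⊕ (Fin (d + 1) × Fin (d + 1) × Fin (d + 1))) →
      MvPolynomial σ ℤ :=
    Sum.elim (fun _ => C (N : ℤ))
      (Sum.elim (fun vl => C (P vl.1 vl.2)) (fun abl => C (γ abl.1 abl.2.1 abl.2.2))) with hg'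
  set e₂ : Option σ ⊕ ((Fin (4 * Q.size + 1) × Fin (d + 1)) ⊕ (Fin (d + 1) × Fin (d + 1) × Fin (d + 1))) →
      σ ⊕ (Unit ⊕ ((Fin (4 * Q.size + 1) × Fin (d + 1)) ⊕ (Fin (d + 1) × Fin (d + 1) × Fin (d + 1)))) :=
    Sum.elim (fun a => Option.elim a (Sum.inr (Sum.inl ())) Sum.inl) (fun r => Sum.inr (Sum.inr r))
    with he₂
  have hρZe : ρZ = (Sum.elim X g') ∘ e₂ := by
    funext x
    rcases x with (_ | x) | (vl | abl) <;> simp [hρZ, hg', he₂]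
  have hconst : ∀ z : ℤ, z.natAbs ≤ 2 ^ h →
      constantFreeComplexity (C z : MvPolynomial σ ℤ) ≤ 3 * (h + 1) + 1 :=
    fun z hz => constantFreeComplexity_C_le_of_natAbs_le hz
  have hcost : constantFreeComplexity (((N : ℤ) ^ 2 ^ (3 * Q.size)) • f) ≤
      Γc.size + ((3 * (h + 1) + 1) + ((4 * Q.size + 1) * (d + 1) * (3 * (h + 1) + 1) +
        (d + 1) ^ 3 * (3 * (h + 1) + 1))) := by
    rw [← hA0, ← hΓceval, hρZe, ← aeval_rename]
    refine (constantFreeComplexity_aeval_sumElim_le_fintype _ _).trans (add_le_add ?_ ?_)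
    · exact (constantFreeComplexity_rename_le _ _).trans
        (constantFreeComplexity_le_size hΓc2 hΓcs rfl)
    · rw [Fintype.sum_sum_type, Fintype.sum_sum_type, Fintype.sum_unique]
      refine add_le_add ?_ (add_le_add ?_ ?_)
      · simpa [hg'] using hconst (N : ℤ) (by simpa using hNh)
      · refine (Finset.sum_le_card_nsmul _ _ (3 * (h + 1) + 1) fun vl _ => ?_).trans (le_of_eq ?_)
        · simpa [hg'] using hconst _ (hPh vl.1 vl.2)
        · simp only [Finset.card_univ, Fintype.card_prod, Fintype.card_fin, smul_eq_mul]
      · refine (Finset.sum_le_card_nsmul _ _ (3 * (h + 1) + 1) fun abl _ => ?_).trans (le_of_eq ?_)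
        · simpa [hg'] using hconst _ (hγh abl.1 abl.2.1 abl.2.2)
        · simp only [Finset.card_univ, Fintype.card_prod, Fintype.card_fin, smul_eq_mul]
          ring
  -- (6) the circuit
  obtain ⟨Pc, hPc2, hPcs, hPcc, hPcsize⟩ :=
    exists_computes_size_eq_constantFreeComplexity (((N : ℤ) ^ 2 ^ (3 * Q.size)) • f)
  have hsgn : ∀ c : ℤ, IsSignConstant c → c.natAbs ≤ 2 ^ 0 := by
    rintro c (hc0 | hc0 | hc0)
    · subst hc0; simp
    · subst hc0; simp
    · obtain rfl : c = -1 := by omega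
      simp
  have hheight : (∀ g ∈ Pc.gates, ∀ u ∈ g.args, ∀ c : ℤ, u = .const c → c.natAbs ≤ 2 ^ 0) ∧
      (∀ args : List (ℤ × Operand ℤ σ), Gate.sum args ∈ Pc.gates →
        ∀ a ∈ args, a.1.natAbs ≤ 2 ^ 0) ∧
      (∀ c : ℤ, Pc.output = .const c → c.natAbs ≤ 2 ^ 0) := by
    obtain ⟨hg, ho⟩ := hPcs
    refine ⟨?_, fun args hargs a ha => hsgn _ ((hg _ hargs) a ha).1, fun c hcO => hsgn _ (by
      rw [hcO] at ho; exact ho)⟩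
    intro g hgP u hu c huc
    subst huc
    have hgs := hg g hgP
    cases g with
    | sum args =>
      simp only [Gate.args, List.mem_map] at hu
      obtain ⟨a, ha, hau⟩ := hu
      have hh := (hgs a ha).2
      rw [hau] at hh
      exact hsgn _ hh
    | prod args => exact hsgn _ (hgs _ hu)
  refine ⟨Pc, 0, N ^ 2 ^ (3 * Q.size), Nat.one_le_pow _ _ hN1, hPc2, by simpa [Nat.cast_pow] using hPcc,
    hheight, ?_⟩
  have henv := numberField_envelope_le Q.size h d
  have hsizes : Γc.size ≤ (3 * (d + 1) ^ 3 + (d + 1)) * (2 * (3 * Q.size + 2) ^ 2) :=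
    hΓcsize.trans (Nat.mul_le_mul_left _ (by rw [hΓ''size]; exact hΓ'size))
  omega

/-- **`IM` on the bounded-degree bounded-height slice**, in the shape of the stub for the jets
`J_(n,k)` (all `n, k`; the tree's `jet`, rfl-equal to the route's `let J`): a near-optimal
circuit for `J_(n,k)` over a number field given with a `ℚ`-basis `β ∋ 1` of integer
multiplication table and height-`2^h` integer coordinates of its constants (common denominator
`N`) yields `P`, `t = 0`, `M = N^(2^(3 size Q))` with
`size P + t + 2 ≤ 128 (d+1)³ (size Q + h + 2)²` — polynomial in `size Q + n` as soon as the
DEGREE `d + 1` and the HEIGHT `h` are; that these can be taken polynomial for near-optimal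
circuits of the jets is the height normal form, the open content of `stub_integralMultiple`.
[folklore] -/
theorem integralMultiple_numberFieldSlice (n k : ℕ) {K : Type*} [Field K] [CharZero K] {d : ℕ}
    (β : Fin (d + 1) → K) (hβ0 : β 0 = 1) (hind : LinearIndependent ℚ β)
    (γ : Fin (d + 1) → Fin (d + 1) → Fin (d + 1) → ℤ)
    (hβ : ∀ a b, β a * β b = ∑ l, (γ a b l : K) * β l)
    (Q : ArithCircuit K (Fin n × Fin n)) (h2 : Q.IsFanInTwo)
    (hc : Q.Computes (MvPolynomial.map (Int.castRingHom K) (jet n k))) (N h : ℕ) (hN1 : 1 ≤ N)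
    (hNh : N ≤ 2 ^ h) (P : Fin (4 * Q.size + 1) → Fin (d + 1) → ℤ)
    (hP : ∀ v : Fin (4 * Q.size + 1), (N : K) * slotConst Q v = ∑ l, (P v l : K) * β l)
    (hPh : ∀ v l, (P v l).natAbs ≤ 2 ^ h) (hγh : ∀ a b l, (γ a b l).natAbs ≤ 2 ^ h) :
    ∃ (Pc : ArithCircuit ℤ (Fin n × Fin n)) (t M : ℕ),
      1 ≤ M ∧ Pc.IsFanInTwo ∧ Pc.Computes ((M : ℤ) • jet n k) ∧
      ((∀ g ∈ Pc.gates, ∀ u ∈ g.args, ∀ c : ℤ, u = .const c → c.natAbs ≤ 2 ^ t) ∧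
        (∀ args : List (ℤ × Operand ℤ (Fin n × Fin n)), Gate.sum args ∈ Pc.gates →
          ∀ a ∈ args, a.1.natAbs ≤ 2 ^ t) ∧
        (∀ c : ℤ, Pc.output = .const c → c.natAbs ≤ 2 ^ t)) ∧
      Pc.size + t + 2 ≤ 128 * (d + 1) ^ 3 * (Q.size + h + 2) ^ 2 :=
  exists_integralMultiple_of_numberField_circuit (jet n k) β hβ0 hind γ hβ Q h2 hc N h hN1 hNh P hP
    hPh hγh

end Summit.ValiantsHypothesis.ValiantsHypothesis.Theorems.AnyonJets.JetConstantElim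

end
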